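import Summits.QuantumFields.BalabanUV.T4Continuum.Support.AveragingDeficitTransport

/-!
# AveragingDeficitLocality (T⁴ programme, node NE3, row NE3-R2; file 2/3 of the transport layer) — LOCALITY of the
# transport (9), the loop variables and the average (42), the coarse plaquette variable (44) and the dressed curl under
# the perturbation `V e^{sψ}`, and GAUGE COVARIANCE of the perturbation and of the dressed curl

Purpose, honest framing, citation header and placement: see the header of `AveragingDeficitTransport` (file 1/3), of
which this is the continuation (split only for the 400-line rule).  In one sentence: β = `DeficitDerivWall` quantifies
`∀ᶠ W` over window pairs and over finitely supported directions `ψ`; the lemmas here certify that every coarse term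
`wt(V̄_s(∂P))` and fine term `wt(V_s(∂p))` of the deficit is INDEPENDENT of `s` once `ψ` vanishes within `ℓ¹`-distance
`(2d+3)L` (resp. `4`) of the plaquette's corner — the finite dependence set of the derivative — and that the gauge action
(11)/(45) intertwines the perturbations, `(V e^{sψ})^u = V^u e^{sψ^u}` with `ψ^u(b) = Ad_{u(b₊)}ψ(b)`, carrying the dressed
curl covariantly, `d_{V^u}ψ^u = Ad_u d_Vψ` (the step to the axial gauge of B7 p. 24 for the derivative, as
`T4AveragingDeficitNonAbelian.wt_chol_le` does it for the value).  All statements are [folklore] bookkeeping on the tree's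
transcriptions `hol` (9), `Wcx`/`Xavg`/`bavg` (42), `cplaq` (44), `gaugeAct` (11)/(45) of [Balaban1985Averaging]
(T. Bałaban, Commun. Math. Phys. **98** (1985) 17–51); the `[cite:]` tags name those formulas as CONTEXT; nothing printed
is a hypothesis; NOT β, NOT NE3, no BetaPertH/(B)/(B^μ); finite-T⁴ rung (B)+1, not Clay.
-/

set_option autoImplicit false

open scoped BigOperators Matrix Matrix.Norms.L2Operator Topology
open NormedSpace Finset Filter

namespace Summit.QuantumFields.BalabanUV.T4Continuum.AveragingDeficitLocality

open Literature.MathematicalPhysics.QuantumFieldTheory.Balaban1983to89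

open B7Prop1Explicit B7Prop2Explicit MatrixLog UnitaryModel
open T4AveragingDeficitWall hiding Site Plane Plaq Bond
open T4AveragingDeficitNonAbelian (Ad_mul Ad_sub)
open AveragingDeficitTransport

noncomputable section

variable {d : ℕ} {n : Type*} [Fintype n] [DecidableEq n]

local notation "𝕄" => Matrix n n ℂ
local notation "Site" => B7Prop1Explicit.Site

/-! ## §3 Locality: the transport along `V e^{sψ}` sees `ψ` only on the bonds of the word -/

/-- The bonds `⟨b₋, b₋ + e_κ⟩` (as pairs `(b₋, κ)`) traversed by the word `w` spelled from `x`. [folklore] -/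
def bondsOf : Site d → List (Letter d) → List (Site d × Fin d)
  | _, [] => []
  | x, l :: w => (if l.2 then (x, l.1) else (x + l.vec, l.1)) :: bondsOf (x + l.vec) w

/-- `bondsOf` of the empty word. [folklore] -/
@[simp] theorem bondsOf_nil (x : Site d) : bondsOf x ([] : List (Letter d)) = [] := rfl

/-- `bondsOf` of a cons. [folklore] -/
@[simp] theorem bondsOf_cons (x : Site d) (l : Letter d) (w : List (Letter d)) :
    bondsOf x (l :: w) = (if l.2 then (x, l.1) else (x + l.vec, l.1)) :: bondsOf (x + l.vec) w := rfl

/-- Every bond of a word of length `n` from `x` starts within `ℓ¹`-distance `n` of `x`. [folklore] -/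
theorem l1_le_of_mem_bondsOf : ∀ (x : Site d) (w : List (Letter d)) (b : Site d × Fin d),
    b ∈ bondsOf x w → l1 (b.1 - x) ≤ w.length
  | x, [], b, hb => by simp at hb
  | x, l :: w, b, hb => by
    rw [bondsOf_cons, List.mem_cons] at hb
    rw [List.length_cons]
    rcases hb with hb | hb
    · split_ifs at hb
      · subst hb; simp [l1]
      · subst hb
        simp only [add_sub_cancel_left, l1_vec]
        omega
    · have ih := l1_le_of_mem_bondsOf (x + l.vec) w b hb
      have := l1_add_le (b.1 - (x + l.vec)) l.vec
      rw [l1_vec, show b.1 - (x + l.vec) + l.vec = b.1 - x by abel] at this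
      omega

/-- A letter's transport along `V e^{sψ}` is unchanged when `ψ` vanishes on its bond. [folklore] -/
theorem stepHol_vary_eq_of_eq_zero (V : Site d → Fin d → 𝕄ˣ) {ψ : Site d → Fin d → 𝕄} (x : Site d)
    (l : Letter d) (h : ψ (if l.2 then x else x + l.vec) l.1 = 0) (s : ℝ) :
    stepHol (vary V ψ s) x l = stepHol V x l := by
  obtain ⟨μ, b⟩ := l
  cases b
  · simp only [Bool.false_eq_true, ↓reduceIte] at h
    simp only [stepHol, Bool.false_eq_true, ↓reduceIte, vary_eq_of_eq_zero V h s]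
  · simp only [↓reduceIte] at h
    simp only [stepHol, ↓reduceIte, vary_eq_of_eq_zero V h s]

/-- **Locality of (9)**: if `ψ` vanishes on every bond of the word, `V_s(Γ) = V(Γ)` for all `s`. [folklore] -/
theorem hol_vary_eq_of_forall (V : Site d → Fin d → 𝕄ˣ) {ψ : Site d → Fin d → 𝕄} (s : ℝ) :
    ∀ (x : Site d) (w : List (Letter d)), (∀ b ∈ bondsOf x w, ψ b.1 b.2 = 0) →
      hol (vary V ψ s) x w = hol V x w
  | x, [], _ => by simp
  | x, l :: w, h => by
    rw [hol_cons, hol_cons, hol_vary_eq_of_forall V s (x + l.vec) w fun b hb => h b (by simp [hb]),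
      stepHol_vary_eq_of_eq_zero V x l ?_ s]
    have := h (if l.2 then (x, l.1) else (x + l.vec, l.1)) (by simp)
    obtain ⟨μ, b⟩ := l
    cases b <;> simpa using this

/-- **Locality by distance**: if `ψ` vanishes on every bond starting within `ℓ¹`-distance `|Γ|` of `x`, then
`V_s(Γ) = V(Γ)`. [folklore] -/
theorem hol_vary_eq_of_l1 (V : Site d → Fin d → 𝕄ˣ) {ψ : Site d → Fin d → 𝕄} (s : ℝ) (x : Site d)
    (w : List (Letter d)) (h : ∀ (x' : Site d) (κ : Fin d), l1 (x' - x) ≤ w.length → ψ x' κ = 0) :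
    hol (vary V ψ s) x w = hol V x w :=
  hol_vary_eq_of_forall V s x w fun b hb => h b.1 b.2 (l1_le_of_mem_bondsOf x w b hb)

/-- `l1` of a block offset vector is at most `d·L` (re-export of the tree bound in the form used here). [folklore] -/
private theorem l1_boxVec_le' (L : ℕ) (r : Fin d → Fin L) : l1 (boxVec L r) ≤ d * L := l1_boxVec_le L r

/-- **Locality of the loop variables of (42)**: `V_s(Γ_{c,x})V_s(c)⁻¹ = V(Γ_{c,x})V(c)⁻¹` whenever `ψ` vanishes on all
bonds within `ℓ¹`-distance `(2d+2)L` of `c₋ = q`. [cite: Balaban1985Averaging, (42) p.23] -/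
theorem Wcx_vary_eq_of_l1 (L : ℕ) (V : Site d → Fin d → 𝕄ˣ) {ψ : Site d → Fin d → 𝕄} (s : ℝ) (q : Site d)
    (κ : Fin d) (r : Fin d → Fin L)
    (h : ∀ (x' : Site d) (κ' : Fin d), l1 (x' - q) ≤ (2 * d + 2) * L → ψ x' κ' = 0) :
    Wcx L (vary V ψ s) q κ (boxVec L r) = Wcx L V q κ (boxVec L r) := by
  unfold Wcx
  have hlen : (gammaWord L κ (boxVec L r)).length ≤ (2 * d + 2) * L := by
    rw [length_gammaWord]
    have := l1_boxVec_le' L r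
    nlinarith
  rw [hol_vary_eq_of_l1 V s q _ fun x' κ' hx' => h x' κ' (hx'.trans hlen),
    hol_vary_eq_of_l1 V s q _ fun x' κ' hx' => h x' κ' (hx'.trans ?_)]
  rw [length_seg, Int.natAbs_natCast]
  nlinarith

/-- **Locality of the average (42)**: `\overline{V_s}(c) = V̄(c)` whenever `ψ` vanishes on all bonds within
`ℓ¹`-distance `(2d+2)L` of `c₋`. [cite: Balaban1985Averaging, (42) p.23] -/
theorem bavg_vary_eq_of_l1 (L : ℕ) (V : Site d → Fin d → 𝕄ˣ) {ψ : Site d → Fin d → 𝕄} (s : ℝ) (q : Site d)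
    (κ : Fin d) (h : ∀ (x' : Site d) (κ' : Fin d), l1 (x' - q) ≤ (2 * d + 2) * L → ψ x' κ' = 0) :
    bavg L (vary V ψ s) q κ = bavg L V q κ := by
  unfold bavg Xavg
  have hW : ∀ r : Fin d → Fin L, Wcx L (vary V ψ s) q κ (boxVec L r) = Wcx L V q κ (boxVec L r) := fun r =>
    Wcx_vary_eq_of_l1 L V s q κ r h
  simp only [hW]
  rw [hol_vary_eq_of_l1 V s q _ fun x' κ' hx' => h x' κ' (hx'.trans ?_)]
  rw [length_seg, Int.natAbs_natCast]
  nlinarith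

/-- `l1 (L e_μ) = L`. [folklore] -/
private theorem l1_natCast_smul_e (L : ℕ) (μ : Fin d) : l1 ((L : ℤ) • (e μ : Site d)) = L := by
  rw [l1_zsmul_e, Int.natAbs_natCast]

/-- **Locality of the coarse plaquette variable (44) of the averaged configuration**: `\overline{V_s}(∂P) = V̄(∂P)`
for the coarse plaquette with fine corner `z` whenever `ψ` vanishes on all bonds within `ℓ¹`-distance `(2d+3)L` of
`z`. [cite: Balaban1985Averaging, (42) p.23, (44) p.24] -/
theorem cplaq_bavg_vary_eq_of_l1 (L : ℕ) (V : Site d → Fin d → 𝕄ˣ) {ψ : Site d → Fin d → 𝕄} (s : ℝ)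
    (z : Site d) (μ ν : Fin d)
    (h : ∀ (x' : Site d) (κ' : Fin d), l1 (x' - z) ≤ (2 * d + 3) * L → ψ x' κ' = 0) :
    cplaq L (bavg L (vary V ψ s)) z μ ν = cplaq L (bavg L V) z μ ν := by
  have key : ∀ (q : Site d) (κ : Fin d), l1 (q - z) ≤ L → bavg L (vary V ψ s) q κ = bavg L V q κ := by
    intro q κ hq
    refine bavg_vary_eq_of_l1 L V s q κ fun x' κ' hx' => h x' κ' ?_
    have := l1_add_le (x' - q) (q - z)
    rw [show x' - q + (q - z) = x' - z by abel] at this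
    nlinarith
  unfold cplaq
  rw [key z μ (by simp [l1]), key _ ν (by rw [add_sub_cancel_left, l1_natCast_smul_e]),
    key _ μ (by rw [add_sub_cancel_left, l1_natCast_smul_e]), key z ν (by simp [l1])]

/-- **Locality of `V̄(∂P)` on indexed coarse plaquettes** (`chol`, fine corner `L•y`). [folklore] -/
theorem chol_vary_eq_of_l1 (L : ℕ) (V : Site d → Fin d → 𝕄ˣ) {ψ : Site d → Fin d → 𝕄} (s : ℝ)
    (P : T4AveragingDeficitWall.Plaq d)
    (h : ∀ (x' : Site d) (κ' : Fin d), l1 (x' - (L : ℤ) • P.1) ≤ (2 * d + 3) * L → ψ x' κ' = 0) :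
    chol L (vary V ψ s) P = chol L V P :=
  cplaq_bavg_vary_eq_of_l1 L V s _ _ _ h

/-- **Locality of the fine plaquette variable**: `V_s(∂p) = V(∂p)` whenever `ψ` vanishes on all bonds within
`ℓ¹`-distance `4` of the corner. [folklore] -/
theorem fhol_vary_eq_of_l1 (V : Site d → Fin d → 𝕄ˣ) {ψ : Site d → Fin d → 𝕄} (s : ℝ)
    (p : T4AveragingDeficitWall.Plaq d) (h : ∀ (x' : Site d) (κ' : Fin d), l1 (x' - p.1) ≤ 4 → ψ x' κ' = 0) :
    fhol (vary V ψ s) p = fhol V p := by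
  unfold fhol
  exact hol_vary_eq_of_l1 V s p.1 _ fun x' κ' hx' => h x' κ' (hx'.trans (by simp [plaqWord]))

/-- **Locality of the dressed curl**: `(d_Vψ)(p) = 0` whenever `ψ` vanishes on all bonds within `ℓ¹`-distance `4`
of the corner. [folklore] -/
theorem curl_eq_zero_of_l1 (V : Site d → Fin d → 𝕄ˣ) {ψ : Site d → Fin d → 𝕄}
    (p : T4AveragingDeficitWall.Plaq d) (h : ∀ (x' : Site d) (κ' : Fin d), l1 (x' - p.1) ≤ 4 → ψ x' κ' = 0) :
    curl V ψ p = 0 := by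
  have h1 := hasDerivAt_fhol_vary V ψ p
  have h2 : HasDerivAt (fun s : ℝ => ((fhol (vary V ψ s) p : 𝕄ˣ) : 𝕄)) 0 0 := by
    refine (hasDerivAt_const (0 : ℝ) ((fhol V p : 𝕄ˣ) : 𝕄)).congr_of_eventuallyEq ?_
    exact Filter.Eventually.of_forall fun s => by
      show ((fhol (vary V ψ s) p : 𝕄ˣ) : 𝕄) = _
      rw [fhol_vary_eq_of_l1 V s p h]
  have h := h1.unique h2
  have h' : curl V ψ p * ((fhol V p : 𝕄ˣ) : 𝕄) * (((fhol V p)⁻¹ : 𝕄ˣ) : 𝕄) = 0 := by rw [h, zero_mul]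
  rwa [Units.mul_inv_cancel_right] at h'

/-! ## §5 Gauge covariance of the linearised objects -/

/-- The direction field transforms COvariantly at the END point of its bond: `ψ^u(x,κ) = Ad_{u(x+e_κ)}ψ(x,κ)`, so that
`(V e^{sψ})^u = V^u e^{sψ^u}`. [folklore] -/
def dirGauge (u : Site d → 𝕄ˣ) (ψ : Site d → Fin d → 𝕄) : Site d → Fin d → 𝕄 :=
  fun x κ => Ad (u (x + e κ)) (ψ x κ)

/-- `e^{Ad_u X} = u e^X u⁻¹` as units. [folklore] -/
theorem expUnit_Ad (u : 𝕄ˣ) (X : 𝕄) : expUnit (Ad u X) = u * expUnit X * u⁻¹ := by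
  letI : NormedAlgebra ℚ 𝕄 := NormedAlgebra.restrictScalars ℚ ℝ 𝕄
  apply Units.ext
  simp only [val_expUnit, Units.val_mul, Ad]
  exact exp_units_conj u X

/-- **`(V e^{sψ})^u = V^u e^{sψ^u}`**: the gauge action (45)/(11) intertwines the perturbations. [cite: Balaban1985Averaging, (11) p.19, (45) p.24] -/
theorem gaugeAct_vary (u : Site d → 𝕄ˣ) (V : Site d → Fin d → 𝕄ˣ) (ψ : Site d → Fin d → 𝕄) (s : ℝ) :
    gaugeAct u (vary V ψ s) = vary (gaugeAct u V) (dirGauge u ψ) s := by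
  funext x κ
  simp only [gaugeAct, vary, dirGauge]
  rw [show (s : ℂ) • Ad (u (x + e κ)) (ψ x κ) = Ad (u (x + e κ)) ((s : ℂ) • ψ x κ) by
    unfold Ad; rw [Matrix.mul_smul, Matrix.smul_mul], expUnit_Ad]
  simp only [mul_assoc, inv_mul_cancel_left]

/-- The gauged direction has the same pointwise norms (unitary `u`). [folklore] -/
theorem norm_dirGauge {u : Site d → 𝕄ˣ} (hu : ∀ x, u x ∈ unitaryUnits 𝕄) (ψ : Site d → Fin d → 𝕄) (x : Site d)
    (κ : Fin d) : ‖dirGauge u ψ x κ‖ = ‖ψ x κ‖ :=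
  norm_Ad_of_unitary (hu _) _

/-- The gauged direction is skew if `ψ` is (unitary `u`). [folklore] -/
theorem dirGauge_skew {u : Site d → 𝕄ˣ} (hu : ∀ x, u x ∈ unitaryUnits 𝕄) {ψ : Site d → Fin d → 𝕄}
    (hψ : IsSkewDir ψ) : IsSkewDir (dirGauge u ψ) := fun x κ => Ad_mem_skewAdjoint (hu _) (hψ x κ)

/-- The gauged direction vanishes where `ψ` does. [folklore] -/
theorem dirGauge_eq_zero {u : Site d → 𝕄ˣ} {ψ : Site d → Fin d → 𝕄} {x : Site d} {κ : Fin d} (h : ψ x κ = 0) :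
    dirGauge u ψ x κ = 0 := by
  simp [dirGauge, h, Ad]

/-- **Covariance of the dressed curl**: `(d_{V^u}ψ^u)(p) = Ad_{u(p)} (d_Vψ)(p)` (both sides are the left-trivialised
derivative of `V^u_s(∂p) = u(p) V_s(∂p) u(p)⁻¹`). [cite: Balaban1985Averaging, (11) p.19] -/
theorem curl_gaugeAct (u : Site d → 𝕄ˣ) (V : Site d → Fin d → 𝕄ˣ) (ψ : Site d → Fin d → 𝕄)
    (p : T4AveragingDeficitWall.Plaq d) :
    curl (gaugeAct u V) (dirGauge u ψ) p = Ad (u p.1) (curl V ψ p) := by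
  have h1 := hasDerivAt_fhol_vary (gaugeAct u V) (dirGauge u ψ) p
  have h2 : HasDerivAt (fun s : ℝ => ((fhol (vary (gaugeAct u V) (dirGauge u ψ) s) p : 𝕄ˣ) : 𝕄))
      ((u p.1 : 𝕄) * (curl V ψ p * ((fhol V p : 𝕄ˣ) : 𝕄)) * ((u p.1)⁻¹ : 𝕄ˣ)) 0 := by
    have h := ((hasDerivAt_fhol_vary V ψ p).const_mul ((u p.1 : 𝕄ˣ) : 𝕄)).mul_const (((u p.1)⁻¹ : 𝕄ˣ) : 𝕄)
    refine h.congr_of_eventuallyEq (Filter.Eventually.of_forall fun s => ?_)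
    simp only [fhol]
    rw [← gaugeAct_vary, hol_gaugeAct_closed _ _ _ _ (disp_plaqWord _ _), Units.val_mul, Units.val_mul]
  have h := h1.unique h2
  have hf : ((fhol (gaugeAct u V) p : 𝕄ˣ) : 𝕄) = (u p.1 : 𝕄) * ((fhol V p : 𝕄ˣ) : 𝕄) * ((u p.1)⁻¹ : 𝕄ˣ) := by
    simp only [fhol]
    rw [hol_gaugeAct_closed _ _ _ _ (disp_plaqWord _ _), Units.val_mul, Units.val_mul]
  rw [hf] at h
  -- cancel the unit `u V(∂p) u⁻¹` on the right
  have h' : curl (gaugeAct u V) (dirGauge u ψ) p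
      = ((u p.1 : 𝕄) * (curl V ψ p * ((fhol V p : 𝕄ˣ) : 𝕄)) * ((u p.1)⁻¹ : 𝕄ˣ))
        * ((u p.1 : 𝕄) * (((fhol V p)⁻¹ : 𝕄ˣ) : 𝕄) * ((u p.1)⁻¹ : 𝕄ˣ)) := by
    rw [← h]
    simp only [mul_assoc, Units.inv_mul_cancel_left, Units.mul_inv_cancel_left, Units.mul_inv, mul_one]
  rw [h']
  unfold Ad
  simp only [mul_assoc, Units.inv_mul_cancel_left, Units.mul_inv_cancel_left]


end

end Summit.QuantumFields.BalabanUV.T4Continuum.AveragingDeficitLocality
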